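import Literature.GroupTheory.CombinatorialGroupTheory.QuadraticSystems
import Mathlib.Data.Fintype.Card
import HarnessLib

/-!
# Coverings of face systems: vertices upstairs, and contraction of a spanning tree

Topic `Literature/GroupTheory/CombinatorialGroupTheory`; continues `QuadraticSystems.lean`.
Combinatorial covering-space theory for 2-complexes recorded as SYSTEMS OF FACES (ZVC §3.1, and
the proof of Thm. 4.14.1 / §4.14: "the Reidemeister–Schreier rewriting of a planar presentation is
planar"), in the letters formalism of `QuadraticWordsVertexDefs.lean` / `QuadraticSystems.lean`
(`sysPerm`, `bar`, `delPerm`).  Two abstract statements, free of any group theory, which the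
Schreier ribbon graph of a finite-index subgroup of a free / surface group instantiates:

* `sameCycle_sysPerm_iff_of_covering` — **the vertices of a covering are the fibres of the vertex
  map.**  If a face system `Fs` (letters `κ × Bool`) lies over a face system `S` (letters
  `ι × Bool`) through a projection `π` commuting with `bar` and with the successor-in-the-face maps,
  if a "vertex map" `v` on the upstairs letters satisfies the path condition
  `v (successor of l) = v (l̄)` and `(π, v)` is jointly injective, and the base system has ONE
  vertex (`sysPerm S` transitive), then two upstairs letters lie in one cycle of `sysPerm Fs` iff
  they have the same vertex: the covering complex has exactly one vertex over each point.
* `sysPerm_mul_delPerm_transitive_of_tree` — **contracting a spanning tree.**  If the cycles of a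
  permutation `σ` of the letters are the fibres of `v : letters → A` (`A` finite) and for every
  `a ≠ a₀` a "tree letter" `y a` runs from `parent a` to `a`, parents being strictly closer to
  `a₀` for a rank function `dist`, then `σ * delPerm D` is TRANSITIVE, `D` = the tree letters and
  their partners.  With `sameCycle_sysPerm_filter` (`QuadraticSystems.lean`: deleting `D` from the
  faces yields the first return of `σ * delPerm D`) this says: deleting the edges of a spanning
  tree from all faces leaves a ONE-VERTEX system (ZVC 3.1.6 (b), 4.14).  The proof merges the
  vertex cycles one tree edge at a time (`sameCycle_of_swap_merge`, `PermutationCycleSurgery.lean`),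
  processing the vertices by increasing `dist`.

## References

* H. Zieschang, E. Vogt, H.-D. Coldewey, *Surfaces and Planar Discontinuous Groups*, LNM 835,
  Springer 1980, 3.1.2, 3.1.6, 4.14.1. [ZieschangVogtColdewey1980]
-/

namespace Literature.GroupTheory.CombinatorialGroupTheory

open List Equiv Equiv.Perm

/-! ### The vertices of a covering of face systems -/

section Covering

variable {ι κ A : Type*} [DecidableEq ι] [DecidableEq κ]

/-- **Equivariance of the vertex permutations of a covering**: if the projection `π` commutes with
`bar` and with the successor maps of the two face systems, it intertwines the vertex permutations.
[cite: ZieschangVogtColdewey1980, 3.1.2] -/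
theorem proj_sysPerm_of_covering (S : List (List (ι × Bool))) (Fs : List (List (κ × Bool)))
    (π : κ × Bool → ι × Bool) (hπbar : ∀ l, π (bar l) = bar (π l))
    (hπnext : ∀ l, π ((Fs.map List.formPerm).prod l) = (S.map List.formPerm).prod (π l))
    (l : κ × Bool) : π (sysPerm Fs l) = sysPerm S (π l) := by
  rw [sysPerm_apply, sysPerm_apply, hπnext, hπbar]

/-- Iterated equivariance: `π ∘ (sysPerm Fs)^n = (sysPerm S)^n ∘ π`. [cite: ZieschangVogtColdewey1980, 3.1.2] -/
theorem proj_sysPerm_pow_of_covering (S : List (List (ι × Bool))) (Fs : List (List (κ × Bool)))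
    (π : κ × Bool → ι × Bool) (hπbar : ∀ l, π (bar l) = bar (π l))
    (hπnext : ∀ l, π ((Fs.map List.formPerm).prod l) = (S.map List.formPerm).prod (π l))
    (n : ℕ) (l : κ × Bool) : π ((sysPerm Fs ^ n) l) = (sysPerm S ^ n) (π l) := by
  induction n with
  | zero => rfl
  | succ n ih =>
    rw [pow_succ', Perm.mul_apply, proj_sysPerm_of_covering S Fs π hπbar hπnext, ih, pow_succ',
      Perm.mul_apply]

/-- **The vertex permutation of a covering preserves the vertex map**, given the path condition
`v (successor of l) = v l̄` ("the letter after `l` starts where `l` ends").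
[cite: ZieschangVogtColdewey1980, 3.1.2] -/
theorem vertexMap_sysPerm_of_path (Fs : List (List (κ × Bool))) (v : κ × Bool → A)
    (hv : ∀ l, v ((Fs.map List.formPerm).prod l) = v (bar l)) (l : κ × Bool) :
    v (sysPerm Fs l) = v l := by
  rw [sysPerm_apply, hv, bar_bar]

/-- Iterated form: `v ∘ (sysPerm Fs)^n = v`. [cite: ZieschangVogtColdewey1980, 3.1.2] -/
theorem vertexMap_sysPerm_pow_of_path (Fs : List (List (κ × Bool))) (v : κ × Bool → A)
    (hv : ∀ l, v ((Fs.map List.formPerm).prod l) = v (bar l)) (n : ℕ) (l : κ × Bool) :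
    v ((sysPerm Fs ^ n) l) = v l := by
  induction n with
  | zero => rfl
  | succ n ih => rw [pow_succ', Perm.mul_apply, vertexMap_sysPerm_of_path Fs v hv, ih]

/-- **The vertices of a covering are the fibres of the vertex map.**  Let the face system `Fs`
(letters `κ × Bool`) lie over the face system `S` (letters `ι × Bool`, `ι` finite) through a
projection `π` commuting with `bar` and with the successor maps, let `v` satisfy the path
condition, and let `(π, v)` be jointly injective (an edge letter is determined by the letter under
it and its vertex).  If `S` has one vertex, then two letters upstairs lie in the same cycle of
`sysPerm Fs` iff they have the same vertex — the covering complex has one vertex over each point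
(ZVC 3.1.2 with §4.14: "over each vertex of the base lies `[G : U]` vertices").
[cite: ZieschangVogtColdewey1980, 4.14.1] -/
theorem sameCycle_sysPerm_iff_of_covering [Finite ι] (S : List (List (ι × Bool)))
    (Fs : List (List (κ × Bool))) (π : κ × Bool → ι × Bool) (v : κ × Bool → A)
    (hπbar : ∀ l, π (bar l) = bar (π l))
    (hπnext : ∀ l, π ((Fs.map List.formPerm).prod l) = (S.map List.formPerm).prod (π l))
    (hv : ∀ l, v ((Fs.map List.formPerm).prod l) = v (bar l))
    (hinj : ∀ l l', π l = π l' → v l = v l' → l = l')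
    (htrans : ∀ x y : ι × Bool, (sysPerm S).SameCycle x y) (l l' : κ × Bool) :
    (sysPerm Fs).SameCycle l l' ↔ v l = v l' := by
  constructor
  · rintro ⟨i, rfl⟩
    -- an integer power: reduce to natural powers of `sysPerm Fs` and of its inverse
    obtain ⟨n, rfl | rfl⟩ := Int.eq_nat_or_neg i
    · rw [zpow_natCast, vertexMap_sysPerm_pow_of_path Fs v hv]
    · have h := vertexMap_sysPerm_pow_of_path Fs v hv n ((sysPerm Fs ^ (-(n : ℤ))) l)
      rw [← Perm.mul_apply, ← zpow_natCast, ← zpow_add, add_neg_cancel, zpow_zero,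
        Perm.one_apply] at h
      exact h
  · intro hvl
    obtain ⟨n, hn⟩ := (htrans (π l) (π l')).exists_nat_pow_eq
    have h1 : π ((sysPerm Fs ^ n) l) = π l' := by
      rw [proj_sysPerm_pow_of_covering S Fs π hπbar hπnext, hn]
    have h2 : v ((sysPerm Fs ^ n) l) = v l' := by
      rw [vertexMap_sysPerm_pow_of_path Fs v hv, hvl]
    exact ⟨n, by rw [zpow_natCast]; exact hinj _ _ h1 h2⟩

end Covering

/-! ### Merging cycles along a transposition: the complement is untouched -/

section Merge

variable {β : Type*} [DecidableEq β]

/-- **Cycles away from a merge are unchanged.**  If `u`, `w` lie in different cycles of `ρ`... or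
not: in any case, for a letter `x` in neither the `ρ`-cycle of `u` nor that of `w`, the cycle of
`x` under `ρ * swap u w` is its `ρ`-cycle (the two permutations agree on the `ρ`-stable complement
of the two cycles). [cite: ZieschangVogtColdewey1980, 3.1.6] -/
theorem sameCycle_mul_swap_iff_of_not_sameCycle [Finite β] (ρ : Perm β) (u w : β) {x : β}
    (hxu : ¬ ρ.SameCycle u x) (hxw : ¬ ρ.SameCycle w x) (z : β) :
    (ρ * swap u w).SameCycle x z ↔ ρ.SameCycle x z := by
  -- the complement of the two cycles is stable under both permutations, which agree there
  set T : Set β := {y | ¬ ρ.SameCycle u y ∧ ¬ ρ.SameCycle w y} with hT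
  have hxT : x ∈ T := ⟨hxu, hxw⟩
  have hρT : ∀ y ∈ T, ρ y ∈ T := fun y hy =>
    ⟨fun h => hy.1 (sameCycle_apply_right.1 h), fun h => hy.2 (sameCycle_apply_right.1 h)⟩
  have hagree : ∀ y ∈ T, ρ y = (ρ * swap u w) y := by
    intro y hy
    have hyu : y ≠ u := fun e => hy.1 (e ▸ SameCycle.rfl)
    have hyw : y ≠ w := fun e => hy.2 (e ▸ SameCycle.rfl)
    rw [Perm.mul_apply, swap_apply_of_ne_of_ne hyu hyw]
  have hτT : ∀ y ∈ T, (ρ * swap u w) y ∈ T := fun y hy => by rw [← hagree y hy]; exact hρT y hy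
  constructor
  · exact fun h => SameCycle.of_forall_apply_eq hτT (fun y hy => (hagree y hy).symm) hxT h
  · exact fun h => SameCycle.of_forall_apply_eq hρT hagree hxT h

end Merge

/-! ### Contracting a spanning tree -/

section Tree

variable {κ A : Type*} [DecidableEq κ]

omit [DecidableEq κ] in
/-- A deletion predicate of the form "`x` is one of the tree letters `y b`, `b ∈ P`, or a partner of
one" is `bar`-invariant. [cite: ZieschangVogtColdewey1980, 3.1.6] -/
theorem bar_invariant_of_treeDel (y : A → κ × Bool) (P : Finset A) (D : κ × Bool → Bool)
    (hDP : ∀ x, D x = true ↔ ∃ b ∈ P, x = y b ∨ x = bar (y b)) (x : κ × Bool) :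
    D (bar x) = D x := by
  rw [Bool.eq_iff_iff, hDP, hDP]
  constructor
  · rintro ⟨b, hb, h | h⟩
    · exact ⟨b, hb, Or.inr (by rw [← h, bar_bar])⟩
    · exact ⟨b, hb, Or.inl (bar_injective h)⟩
  · rintro ⟨b, hb, h | h⟩
    · exact ⟨b, hb, Or.inr (by rw [h])⟩
    · exact ⟨b, hb, Or.inl (by rw [h, bar_bar])⟩

omit [DecidableEq κ] in
/-- `delPerm` of the empty deletion set is the identity. [cite: ZieschangVogtColdewey1980, 3.1.6] -/
theorem delPerm_eq_one_of_forall (D : κ × Bool → Bool) (hD : ∀ x, D (bar x) = D x)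
    (h : ∀ x, D x = false) : delPerm D hD = 1 :=
  Equiv.ext fun x => delPerm_apply_of_neg _ (h x)

variable [DecidableEq A]

/-- **Adding one tree edge**: if `D` deletes the tree letters of `insert a P` and `D'` those of
`P`, and the tree letter `y a` is not yet deleted by `D'`, then `delPerm D` is `delPerm D'`
followed by the transposition of `y a` and its partner. [cite: ZieschangVogtColdewey1980, 3.1.6] -/
theorem delPerm_treeDel_insert (y : A → κ × Bool) (P : Finset A) (a : A)
    (D D' : κ × Bool → Bool) (hD : ∀ x, D (bar x) = D x) (hD' : ∀ x, D' (bar x) = D' x)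
    (hDP : ∀ x, D x = true ↔ ∃ b ∈ insert a P, x = y b ∨ x = bar (y b))
    (hD'P : ∀ x, D' x = true ↔ ∃ b ∈ P, x = y b ∨ x = bar (y b))
    (hya : D' (y a) = false) :
    delPerm D hD = delPerm D' hD' * swap (y a) (bar (y a)) := by
  have hya' : D' (bar (y a)) = false := by rw [hD']; exact hya
  refine Equiv.ext fun x => ?_
  rw [Perm.mul_apply]
  by_cases hx1 : x = y a
  · subst hx1
    rw [swap_apply_left, delPerm_apply_of_neg _ hya', delPerm_apply_of_pos]
    exact (hDP _).2 ⟨a, Finset.mem_insert_self _ _, Or.inl rfl⟩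
  by_cases hx2 : x = bar (y a)
  · subst hx2
    rw [swap_apply_right, delPerm_apply_of_neg _ hya, delPerm_apply_of_pos _ ?_, bar_bar]
    exact (hDP _).2 ⟨a, Finset.mem_insert_self _ _, Or.inr rfl⟩
  rw [swap_apply_of_ne_of_ne hx1 hx2]
  by_cases hx : D' x = true
  · rw [delPerm_apply_of_pos _ hx, delPerm_apply_of_pos]
    obtain ⟨b, hb, h⟩ := (hD'P x).1 hx
    exact (hDP x).2 ⟨b, Finset.mem_insert_of_mem hb, h⟩
  · rw [Bool.not_eq_true] at hx
    rw [delPerm_apply_of_neg _ hx, delPerm_apply_of_neg]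
    rw [← Bool.not_eq_true, hDP]
    rintro ⟨b, hb, h⟩
    rcases Finset.mem_insert.1 hb with rfl | hb
    · rcases h with h | h
      · exact hx1 h
      · exact hx2 h
    · have : D' x = true := (hD'P x).2 ⟨b, hb, h⟩
      rw [hx] at this
      exact Bool.false_ne_true this

/-- **Contracting a spanning tree, inductive form.**  Data: a permutation `σ` of the letters whose
cycles are the fibres of the vertex map `v` (`A` finite); a base vertex `a₀`; for each vertex `a`
a "tree letter" `y a` from `parent a` to `a` (`v (y a) = parent a`, `v (ȳ a) = a`), parents being
strictly closer to `a₀` (`dist (parent a) < dist a` for `a ≠ a₀`).  CLAIM, for every set `P ∌ a₀`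
of vertices closed under `parent` (up to `a₀`) and every predicate `D` deleting exactly the tree
letters of `P` and their partners: for `μ = σ * delPerm D`, the letters over `{a₀} ∪ P` form ONE
cycle and the letters over every other vertex still form one cycle each.
[cite: ZieschangVogtColdewey1980, 3.1.6] -/
theorem treeDel_invariant [Finite κ] (σ : Perm (κ × Bool)) (v : κ × Bool → A)
    (hσ : ∀ l l', σ.SameCycle l l' ↔ v l = v l') (a₀ : A) (dist : A → ℕ) (parent : A → A)
    (hpar : ∀ a, a ≠ a₀ → dist (parent a) < dist a) (y : A → κ × Bool)
    (hyv : ∀ a, a ≠ a₀ → v (y a) = parent a) (hyv' : ∀ a, a ≠ a₀ → v (bar (y a)) = a) :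
    ∀ (P : Finset A), a₀ ∉ P → (∀ a ∈ P, parent a = a₀ ∨ parent a ∈ P) →
      ∀ (D : κ × Bool → Bool) (hD : ∀ x, D (bar x) = D x),
        (∀ x, D x = true ↔ ∃ b ∈ P, x = y b ∨ x = bar (y b)) →
      (∀ l l', v l ∈ insert a₀ P → v l' ∈ insert a₀ P → (σ * delPerm D hD).SameCycle l l') ∧
      (∀ l, v l ∉ insert a₀ P → ∀ l', (σ * delPerm D hD).SameCycle l l' ↔ v l = v l') := by
  -- induction on `|P|`, removing a vertex of maximal `dist`
  suffices H : ∀ (n : ℕ) (P : Finset A), P.card = n → a₀ ∉ P → (∀ a ∈ P, parent a = a₀ ∨ parent a ∈ P) →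
      ∀ (D : κ × Bool → Bool) (hD : ∀ x, D (bar x) = D x),
        (∀ x, D x = true ↔ ∃ b ∈ P, x = y b ∨ x = bar (y b)) →
      (∀ l l', v l ∈ insert a₀ P → v l' ∈ insert a₀ P → (σ * delPerm D hD).SameCycle l l') ∧
      (∀ l, v l ∉ insert a₀ P → ∀ l', (σ * delPerm D hD).SameCycle l l' ↔ v l = v l') from
    fun P => H P.card P rfl
  intro n
  induction n with
  | zero =>
    intro P hP ha₀ _ D hD hDP
    rw [Finset.card_eq_zero] at hP
    subst hP
    have hD0 : ∀ x, D x = false := fun x => by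
      rw [← Bool.not_eq_true, hDP]; simp
    rw [delPerm_eq_one_of_forall D hD hD0, mul_one]
    refine ⟨fun l l' hl hl' => ?_, fun l _ l' => hσ l l'⟩
    rw [Finset.insert_empty, Finset.mem_singleton] at hl hl'
    exact (hσ l l').2 (hl.trans hl'.symm)
  | succ n ih =>
    intro P hP ha₀ hclosed D hD hDP
    -- a vertex of `P` of maximal `dist`: nobody's parent, so `P.erase a` is still closed
    have hPne : P.Nonempty := by rw [← Finset.card_pos, hP]; exact Nat.succ_pos n
    obtain ⟨a, haP, hamax⟩ := Finset.exists_max_image P dist hPne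
    have haa₀ : a ≠ a₀ := fun e => ha₀ (e ▸ haP)
    set Q := P.erase a with hQ
    have hQcard : Q.card = n := by rw [hQ, Finset.card_erase_of_mem haP, hP]; rfl
    have ha₀Q : a₀ ∉ Q := fun h => ha₀ (Finset.mem_of_mem_erase h)
    have hQclosed : ∀ b ∈ Q, parent b = a₀ ∨ parent b ∈ Q := by
      intro b hb
      have hbP : b ∈ P := Finset.mem_of_mem_erase hb
      rcases hclosed b hbP with h | h
      · exact Or.inl h
      · refine Or.inr (Finset.mem_erase.2 ⟨fun e => ?_, h⟩)
        have h1 := hpar b (fun e' => ha₀ (e' ▸ hbP))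
        rw [e] at h1
        exact absurd (hamax b hbP) (not_le.2 h1)
    have hPa : P = insert a Q := by rw [hQ, Finset.insert_erase haP]
    -- the deletion predicate of `Q`
    let D' : κ × Bool → Bool := fun x => decide (∃ b ∈ Q, x = y b ∨ x = bar (y b))
    have hD'Q : ∀ x, D' x = true ↔ ∃ b ∈ Q, x = y b ∨ x = bar (y b) := fun x => by
      simp only [D', decide_eq_true_eq]
    have hD' : ∀ x, D' (bar x) = D' x := bar_invariant_of_treeDel y Q D' hD'Q
    obtain ⟨IH1, IH2⟩ := ih Q hQcard ha₀Q hQclosed D' hD' hD'Q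
    -- the parent of `a` is already contracted (or is the root); `a` itself is not
    have hpa : parent a ∈ insert a₀ Q := by
      rcases hclosed a haP with h | h
      · rw [h]; exact Finset.mem_insert_self _ _
      · refine Finset.mem_insert_of_mem (Finset.mem_erase.2 ⟨fun e => ?_, h⟩)
        have h1 := hpar a haa₀
        rw [e] at h1
        exact lt_irrefl _ h1
    have haQ : a ∉ insert a₀ Q := by
      rw [Finset.mem_insert, not_or]; exact ⟨haa₀, Finset.notMem_erase a P⟩
    -- the tree letter of `a` is not among the deleted letters of `Q`
    have hya : D' (y a) = false := by
      rw [← Bool.not_eq_true, hD'Q]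
      rintro ⟨b, hb, e⟩
      have hba₀ : b ≠ a₀ := fun e => ha₀Q (e ▸ hb)
      have hba : b ≠ a := fun e => (Finset.notMem_erase a P) (by rw [e] at hb; exact hb)
      rcases e with e | e
      · -- `y a = y b`: then `a = v (ȳ a) = v (ȳ b) = b`
        have h1 := hyv' a haa₀
        rw [e, hyv' b hba₀] at h1
        exact hba h1
      · -- `y a = ȳ b`: then `parent a = b` and `a = parent b`, contradicting the ranks
        have h1 := hyv a haa₀
        rw [e, hyv' b hba₀] at h1
        have h2 := hyv' a haa₀
        rw [e, bar_bar, hyv b hba₀] at h2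
        have h3 := hpar a haa₀
        have h4 := hpar b hba₀
        rw [← h1] at h3; rw [h2] at h4
        exact absurd (h3.trans h4) (lt_irrefl _)
    have hDP' : ∀ x, D x = true ↔ ∃ b ∈ insert a Q, x = y b ∨ x = bar (y b) := by
      rw [← hPa]; exact hDP
    rw [delPerm_treeDel_insert y Q a D D' hD hD' hDP' hD'Q hya, ← mul_assoc]
    set ρ := σ * delPerm D' hD' with hρ
    set u := y a with hu
    set w := bar (y a) with hw
    -- the merge
    have hvu : v u ∈ insert a₀ Q := by rw [hu, hyv a haa₀]; exact hpa
    have hvw : v w = a := hyv' a haa₀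
    have hnot : ¬ ρ.SameCycle u w := by
      intro h
      have h' := (IH2 w (by rw [hvw]; exact haQ) u).1 h.symm
      rw [hvw] at h'
      exact haQ (h' ▸ hvu)
    have hτu : (ρ * swap u w) u = ρ w := by rw [Perm.mul_apply, swap_apply_left]
    have hτw : (ρ * swap u w) w = ρ u := by rw [Perm.mul_apply, swap_apply_right]
    have hτ : ∀ x, x ≠ u → x ≠ w → (ρ * swap u w) x = ρ x := fun x h1 h2 => by
      rw [Perm.mul_apply, swap_apply_of_ne_of_ne h1 h2]
    have merge : ∀ x, ρ.SameCycle u x ∨ ρ.SameCycle w x → (ρ * swap u w).SameCycle u x :=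
      fun x hx => sameCycle_of_swap_merge hτu hτw hτ hnot hx
    -- letters over `{a₀} ∪ Q ∪ {a}` are now all connected to `u`
    have big : ∀ l, v l ∈ insert a₀ (insert a Q) → (ρ * swap u w).SameCycle u l := by
      intro l hl
      refine merge l ?_
      by_cases hla : v l = a
      · exact Or.inr ((IH2 w (by rw [hvw]; exact haQ) l).2 (hvw.trans hla.symm))
      · refine Or.inl (IH1 u l hvu ?_)
        rw [Finset.insert_comm] at hl
        rcases Finset.mem_insert.1 hl with h | h
        · exact absurd h hla
        · exact h
    rw [hPa]
    refine ⟨fun l l' hl hl' => (big l hl).symm.trans (big l' hl'), fun l hl l' => ?_⟩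
    -- letters over the other vertices: their cycle is untouched
    have hl' : v l ∉ insert a₀ Q := fun e => hl (by
      rw [Finset.insert_comm]; exact Finset.mem_insert_of_mem e)
    have hlu : ¬ ρ.SameCycle u l := fun h => by
      have e := (IH2 l hl' u).1 h.symm
      exact hl' (e ▸ hvu)
    have hlw : ¬ ρ.SameCycle w l := fun h => by
      have e := (IH2 l hl' w).1 h.symm
      rw [hvw] at e
      exact hl (by rw [e]; exact Finset.mem_insert_of_mem (Finset.mem_insert_self _ _))
    rw [sameCycle_mul_swap_iff_of_not_sameCycle ρ u w hlu hlw]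
    exact IH2 l hl' l'

/-- **Contracting a spanning tree leaves one vertex.**  With the data of `treeDel_invariant`
(the cycles of `σ` are the fibres of `v` over the finite vertex set `A`; tree letters `y a` from
`parent a` to `a` for `a ≠ a₀`, parents strictly closer to `a₀`), the permutation
`σ * delPerm D` is transitive, where `D` consists of all tree letters `y a`, `a ≠ a₀`, and their
partners.  (By `sameCycle_sysPerm_filter` its first return to the kept letters — the vertex
permutation of the faces with the tree letters deleted — is then transitive as well: the
contracted complex has a single vertex, ZVC 3.1.6 (b) / §4.14.)
[cite: ZieschangVogtColdewey1980, 4.14.1] -/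
theorem sysPerm_mul_delPerm_transitive_of_tree [Finite κ] [Fintype A] (σ : Perm (κ × Bool))
    (v : κ × Bool → A) (hσ : ∀ l l', σ.SameCycle l l' ↔ v l = v l') (a₀ : A) (dist : A → ℕ)
    (parent : A → A) (hpar : ∀ a, a ≠ a₀ → dist (parent a) < dist a) (y : A → κ × Bool)
    (hyv : ∀ a, a ≠ a₀ → v (y a) = parent a) (hyv' : ∀ a, a ≠ a₀ → v (bar (y a)) = a)
    (D : κ × Bool → Bool) (hD : ∀ x, D (bar x) = D x)
    (hDiff : ∀ x, D x = true ↔ ∃ a, a ≠ a₀ ∧ (x = y a ∨ x = bar (y a))) :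
    ∀ l l', (σ * delPerm D hD).SameCycle l l' := by
  classical
  set P : Finset A := Finset.univ.erase a₀ with hP
  have ha₀ : a₀ ∉ P := Finset.notMem_erase a₀ _
  have hclosed : ∀ a ∈ P, parent a = a₀ ∨ parent a ∈ P := fun a _ => by
    by_cases h : parent a = a₀
    · exact Or.inl h
    · exact Or.inr (Finset.mem_erase.2 ⟨h, Finset.mem_univ _⟩)
  have hDP : ∀ x, D x = true ↔ ∃ b ∈ P, x = y b ∨ x = bar (y b) := fun x => by
    rw [hDiff x]
    simp only [hP, Finset.mem_erase, Finset.mem_univ, and_true]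
  have hall : ∀ l, v l ∈ insert a₀ P := fun l => by
    by_cases h : v l = a₀
    · rw [h]; exact Finset.mem_insert_self _ _
    · exact Finset.mem_insert_of_mem (Finset.mem_erase.2 ⟨h, Finset.mem_univ _⟩)
  obtain ⟨h1, -⟩ := treeDel_invariant σ v hσ a₀ dist parent hpar y hyv hyv' P ha₀ hclosed D hD hDP
  exact fun l l' => h1 l l' (hall l) (hall l')

end Tree

end Literature.GroupTheory.CombinatorialGroupTheory
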